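import Summits.BirchSwinnertonDyer.BirchSwinnertonDyer.Theorems.ManinLocalTwoThreeNegOneTwistConductorAtTwo
import Literature.NumberTheory.DiophantineGeometry.TateAlgorithmIstarCharTwoProofs
import HarnessLib

/-!
# The `χ₋₄`-twist exits of the four `f₂ = 3` types over `ℤ₂`: III ↦ II, I₁* ↦ I₀*, III* ↦ I₂*, II* ↦ I₃*
# (route `ManinLocalTwoThree`, crux C2 `ManinOddAtFour` stmt-BirchSwinnertonDyer-22967; toward an's S-an-60 `NegOneTwistConductorTwoMul`
# «f₂(W) = 3 ⟹ f₂(W ⊗ χ₋₄) = 4»; cell bsd-f2-manin, p2 gen 13)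

Local computations only (Tate's algorithm over `ℤ₂` on explicit models; Silverman *ATAEC* IV.9.4).  For each of the four Kodaira
types with `f₂ = 3` (this seat's `kodairaSymbolAt_of_conductorExponent_eq_three_two`: `III/ord Δ = 4`, `I₁*/8`, `III*/10`, `II*/11`)
the `χ₋₄`-twist of the normal form, after an explicit re-normalisation, exits Tate's algorithm at a type with `m′ = ord Δ − 3`
components, so that Ogg's formula gives `f₂′ = ord Δ + 1 − m′ = 4` (the twist by `−1` does not move `ord Δ`):
* §1 `…_toII`: `(1,0,0,1) • [0, A₂, 0, 2A₄, −(γ² + 4r)]` (`γ` a unit) is of type II (the twist of the `III`-form `[2α, 2β, 2γ, 2q, 4r₁]`);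
* §1 `…_toIstarZero`: `(1,0,α,2) • [0, −(α² + 2A), 0, 8q + 4αγ, −(4γ² + 16r)]` (`γ` a unit) is of type I₀* (twist of the `I₁*`-form
  `[2α, 2β, 4γ, 8q, 16r]`; with `A = 2α₂` it is this seat's IV* exit again);
* §2 `…_toIstarTwo`: `(1,0,α,0) • [0, −(α² + 4p), 0, 8(q + αγ), −16(γ² + 2r)]` (`α, q` units) is of type I₂* (twist of the `III*`-form
  `[2α, 4p, 8γ, 8q, 32r]`): round `0` of the `Iₙ*` sub-procedure fails test A (`a₃ = 0`) and passes test B after `y ↦ y + 4γ`;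
* §3 `…_toIstarThree`: `(1,0,α,0) • [0, −(α² + 4p), 0, 8(αγ + 2q), −16(γ² + 2r)]` (`α, r` units) is of type I₃* (twist of the
  `II*`-form `[2α, 4p, 8γ, 16q, 32r]`): round `0` fails both tests, and after `x ↦ x + 4ρ` with `2 ∣ γ² + r + α²ρ²` round `1` passes
  test A (`γ + αρ` is a unit since its square is `≡ −r`).
The `Iₙ*` rounds are read on user-supplied models by the tree's `kodairaSymbolOfMinimal_eq_Istar_istarIndexAux_self`,
`istarIndexAux_succ_of_testA/_testB/_not_testB` and `testA/B_iff_of_two_eq_zero`.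

HONEST FRAMING: local lemmas of a theorem in print (Barrios et al. 2025 Thm. 5.1, rows III, I₁*, III*, II* with `d ≡ 3 (mod 4)`:
`(f, f^d) = (3, 4)`), kernel-checked for `d = −1`.  Nothing about BSD or Manin's conjecture is proved; C2 OPEN.
[cite: BarriosEtAl2025, Thm. 5.1 (arXiv:2501.03209 pp. 15–16)] [cite: SilvermanATAEC1994, IV.9.4 Steps 1–7 (PDF pp. 344–346)]
-/

set_option autoImplicit false
-- lint-debt: the directory name repeats the summit name (sibling precedent `ManinLocalTwoThreeNegOneTwistConductorAtTwo.lean`)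
set_option linter.dupNamespace false

noncomputable section

open scoped Classical
open Polynomial IsLocalRing WeierstrassCurve
open IsDiscreteValuationRing hiding maximalIdeal
open Literature.NumberTheory.DiophantineGeometry Literature.NumberTheory.DiophantineGeometry.TateAlgorithm
  Literature.NumberTheory.DiophantineGeometry.TateAlgorithm.CharTwo

namespace Summit.BirchSwinnertonDyer.BirchSwinnertonDyer.Theorems.ManinLocalTwoThree

/-! ## §1 The exits at II and I₀* -/

/-- `Δ` of `(1,0,0,t) • [0, A₂, 0, A₄, A₆]` is `16·(A₂²A₄² − 4A₄³ − 4A₂³A₆ − 27A₆² + 18A₂A₄A₆)`. [folklore] -/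
theorem Δ_smul_t_of_a₁_a₃_zero (t A₂ A₄ A₆ : ℤ_[2]) :
    ((⟨1, 0, 0, t⟩ : VariableChange ℤ_[2]) • (⟨0, A₂, 0, A₄, A₆⟩ : WeierstrassCurve ℤ_[2])).Δ =
      16 * (A₂ ^ 2 * A₄ ^ 2 - 4 * A₄ ^ 3 - 4 * A₂ ^ 3 * A₆ - 27 * A₆ ^ 2 + 18 * A₂ * A₄ * A₆) := by
  rw [variableChange_Δ]
  simp only [WeierstrassCurve.Δ, WeierstrassCurve.b₂, WeierstrassCurve.b₄, WeierstrassCurve.b₆, WeierstrassCurve.b₈,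
    inv_one, Units.val_one, one_pow, one_mul]
  ring

/-- **Exit at II.**  For a unit `γ` and any `A₂, A₄, r ∈ ℤ₂`, Tate's algorithm returns `II` on `(1,0,0,1) • [0, A₂, 0, 2A₄, −(γ² + 4r)]`
(Steps 1–3: `2 ∣ Δ, a₃, a₄, a₆, b₂` and `a₆ = −(γ² + 1) − 4r ∈ 2ℤ₂^×`). [cite: SilvermanATAEC1994, IV.9.4 Steps 1–3] -/
theorem kodairaSymbolOfMinimal_negTwist_toII (A₂ A₄ γ r : ℤ_[2]) (hγ : IsUnit γ) :
    ((⟨1, 0, 0, 1⟩ : VariableChange ℤ_[2]) •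
        (⟨0, A₂, 0, 2 * A₄, -(γ ^ 2 + 4 * r)⟩ : WeierstrassCurve ℤ_[2])).kodairaSymbolOfMinimal = .II := by
  obtain ⟨ε, hε, hpε⟩ := Literature.NumberTheory.EllipticCurves.TwistGoodTwo.exists_isUnit_two_eq_uniformizer_mul_padicInt
  obtain ⟨κ, hκ⟩ := exists_eq_one_add_two_mul_of_isUnit_padicInt hγ
  set ϖ : ℤ_[2] := uniformizer ℤ_[2] with hϖ
  set T' : WeierstrassCurve ℤ_[2] := (⟨1, 0, 0, 1⟩ : VariableChange ℤ_[2]) •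
    (⟨0, A₂, 0, 2 * A₄, -(γ ^ 2 + 4 * r)⟩ : WeierstrassCurve ℤ_[2]) with hT'
  have e3 : T'.a₃ = ϖ * ε := by
    rw [hT', variableChange_a₃]; simp; linear_combination hpε
  have e4 : T'.a₄ = ϖ * (ε * A₄) := by
    rw [hT', variableChange_a₄]; simp; linear_combination A₄ * hpε
  have e6 : T'.a₆ = ϖ * (-(ε * (1 + 2 * (κ + κ ^ 2 + r)))) := by
    rw [hT', variableChange_a₆]; simp; rw [hκ]
    linear_combination (-(1 + 2 * (κ + κ ^ 2 + r))) * hpε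
  have eb2 : T'.b₂ = ϖ * (2 * ε * A₂) := by
    rw [WeierstrassCurve.b₂, hT', variableChange_a₁, variableChange_a₂]; simp
    linear_combination (2 * A₂) * hpε
  have hu₆ : IsUnit (-(ε * (1 + 2 * (κ + κ ^ 2 + r)))) := (hε.mul (isUnit_one_add_two_mul_padicInt _)).neg
  have hΔ : ϖ ∣ T'.Δ := by
    rw [hT', Δ_smul_t_of_a₁_a₃_zero]
    refine Dvd.dvd.mul_right ?_ _
    exact ⟨8 * ε, by linear_combination 8 * hpε⟩
  refine kodairaSymbolOfMinimal_eq_II_of_step2 hΔ ?_ ?_ ?_ ?_ ?_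
  · rw [e3]; exact dvd_mul_right _ _
  · rw [e4]; exact dvd_mul_right _ _
  · rw [e6]; exact dvd_mul_right _ _
  · rw [eb2]; exact dvd_mul_right _ _
  · rw [e6, pow_two]
    intro h
    have hϖ0 : ϖ ≠ 0 := irreducible_uniformizer.ne_zero
    have h' : ϖ ∣ -(ε * (1 + 2 * (κ + κ ^ 2 + r))) := by
      obtain ⟨c, hc⟩ := h
      exact ⟨c, mul_left_cancel₀ hϖ0 (by rw [hc]; ring)⟩
    exact (isUnit_iff_not_dvd irreducible_uniformizer _).mp hu₆ h'

/-- **Exit at I₀*.**  For a unit `γ` and any `α, A, q, r ∈ ℤ₂`, Tate's algorithm returns `I₀*` on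
`(1,0,α,2) • [0, −(α² + 2A), 0, 8q + 4αγ, −(4γ² + 16r)]` (Step 6: `2 ∣ a₁, a₂`, `4 ∣ a₃, a₄`, `8 ∣ a₆`, cubic `X³ + P X² + 1` over `𝔽₂`,
discriminant `1`). [cite: SilvermanATAEC1994, IV.9.4 Step 6] -/
theorem kodairaSymbolOfMinimal_negTwist_toIstarZero (α A γ q r : ℤ_[2]) (hγ : IsUnit γ) :
    ((⟨1, 0, α, 2⟩ : VariableChange ℤ_[2]) •
        (⟨0, -(α ^ 2 + 2 * A), 0, 8 * q + 4 * α * γ, -(4 * γ ^ 2 + 16 * r)⟩ : WeierstrassCurve ℤ_[2])).kodairaSymbolOfMinimal =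
      .Istar 0 := by
  obtain ⟨ε, hε, hpε⟩ := Literature.NumberTheory.EllipticCurves.TwistGoodTwo.exists_isUnit_two_eq_uniformizer_mul_padicInt
  obtain ⟨κ, hκ⟩ := exists_eq_one_add_two_mul_of_isUnit_padicInt hγ
  set ϖ : ℤ_[2] := uniformizer ℤ_[2] with hϖ
  set T' : WeierstrassCurve ℤ_[2] := (⟨1, 0, α, 2⟩ : VariableChange ℤ_[2]) •
    (⟨0, -(α ^ 2 + 2 * A), 0, 8 * q + 4 * α * γ, -(4 * γ ^ 2 + 16 * r)⟩ : WeierstrassCurve ℤ_[2]) with hT'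
  have e1 : T'.a₁ = ϖ * (ε * α) := by
    rw [hT', variableChange_a₁]; simp; linear_combination α * hpε
  have e2 : T'.a₂ = ϖ * (-(ε * (α ^ 2 + A))) := by
    rw [hT', variableChange_a₂]; simp; linear_combination -(α ^ 2 + A) * hpε
  have e3 : T'.a₃ = ϖ ^ 2 * ε ^ 2 := by
    rw [hT', variableChange_a₃]; simp
    linear_combination (ϖ * ε + 2) * hpε
  have e4 : T'.a₄ = ϖ ^ 2 * (ϖ * (ε ^ 3 * (q + α * κ))) := by
    rw [hT', variableChange_a₄]; simp; rw [hκ]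
    linear_combination (q + α * κ) * (ϖ ^ 2 * ε ^ 2 + 2 * ϖ * ε + 4) * hpε
  have e6 : T'.a₆ = ϖ ^ 3 * (-(ε ^ 3 * (1 + 2 * (κ + κ ^ 2 + r)))) := by
    rw [hT', variableChange_a₆]; simp; rw [hκ]
    linear_combination (-(1 + 2 * (κ + κ ^ 2 + r))) * (ϖ ^ 2 * ε ^ 2 + 2 * ϖ * ε + 4) * hpε
  have hu₆ : IsUnit (-(ε ^ 3 * (1 + 2 * (κ + κ ^ 2 + r)))) :=
    ((hε.pow 3).mul (isUnit_one_add_two_mul_padicInt _)).neg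
  refine kodairaSymbolOfMinimal_eq_Istar_zero_of_step6 ?_ ?_ ?_ ?_ ?_ ?_
  · rw [e1]; exact dvd_mul_right _ _
  · rw [e2]; exact dvd_mul_right _ _
  · rw [e3]; exact dvd_mul_right _ _
  · rw [e4]; exact dvd_mul_right _ _
  · rw [e6]; exact dvd_mul_right _ _
  · rw [cubicStep6, e2, e4, e6, ← pow_one ϖ, redCoeff_uniformizer_pow_mul, pow_one, redCoeff_uniformizer_pow_mul,
      redCoeff_uniformizer_pow_mul, distinctRootCount_cubic_eq_three_iff]
    have hq : IsLocalRing.residue ℤ_[2] (ϖ * (ε ^ 3 * (q + α * κ))) = 0 :=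
      (IsLocalRing.residue_eq_zero_iff _).mpr
        (Ideal.mul_mem_right _ _ ((mem_maximalIdeal_iff_dvd_of_irreducible irreducible_uniformizer _).mpr dvd_rfl))
    have hr : IsLocalRing.residue ℤ_[2] (-(ε ^ 3 * (1 + 2 * (κ + κ ^ 2 + r)))) ≠ 0 :=
      (IsLocalRing.residue_ne_zero_iff_isUnit _).mpr hu₆
    set P := IsLocalRing.residue ℤ_[2] (-(ε * (α ^ 2 + A)))
    set Rr := IsLocalRing.residue ℤ_[2] (-(ε ^ 3 * (1 + 2 * (κ + κ ^ 2 + r))))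
    rw [hq]
    have h4 : (4 : IsLocalRing.ResidueField ℤ_[2]) = 0 := by
      rw [show (4 : IsLocalRing.ResidueField ℤ_[2]) = 2 * 2 by norm_num, two_eq_zero_residueField_padicInt, mul_zero]
    have h27 : (27 : IsLocalRing.ResidueField ℤ_[2]) = 1 := by
      rw [show (27 : IsLocalRing.ResidueField ℤ_[2]) = 2 * 13 + 1 by norm_num, two_eq_zero_residueField_padicInt,
        zero_mul, zero_add]
    have key : P ^ 2 * 0 ^ 2 - 4 * 0 ^ 3 - 4 * P ^ 3 * Rr - 27 * Rr ^ 2 + 18 * P * 0 * Rr = -(Rr ^ 2) := by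
      rw [h4, h27]; ring
    rw [key, neg_ne_zero]
    exact pow_ne_zero 2 hr

/-! ## §2 The exit at I₂* (the twist of the `III*`-form) -/

/-- **Exit at I₂*.**  For units `α, q` and any `p, γ, r ∈ ℤ₂`, Tate's algorithm returns `I₂*` on
`W₀ = (1,0,α,0) • [0, −(α² + 4p), 0, 8(q + αγ), −16(γ² + 2r)] = [2α, −2(α² + 2p), 0, 8(q + αγ), −16(γ² + 2r)]` (granted `Δ ≠ 0`):
`2 ∣ a₁`, `2 ∥ a₂`, `a₃ = 0`, `8 ∣ a₄`, `16 ∣ a₆` route it to the `Iₙ*` sub-procedure; round `0` fails test A (`a₃ = 0`) and, after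
`y ↦ y + 4γ` (`[2α, −2(α² + 2p), 8γ, 8q, −32(γ² + r)]`), passes test B since `a₄/8 = q` is a unit: `n = 2`.
[cite: SilvermanATAEC1994, IV.9.4 Steps 1–7] -/
theorem kodairaSymbolOfMinimal_negTwist_toIstarTwo (α p γ q r : ℤ_[2]) (hα : IsUnit α) (hq : IsUnit q)
    (hΔ0 : ((⟨1, 0, α, 0⟩ : VariableChange ℤ_[2]) •
        (⟨0, -(α ^ 2 + 4 * p), 0, 8 * (q + α * γ), -(16 * (γ ^ 2 + 2 * r))⟩ : WeierstrassCurve ℤ_[2])).Δ ≠ 0) :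
    ((⟨1, 0, α, 0⟩ : VariableChange ℤ_[2]) •
        (⟨0, -(α ^ 2 + 4 * p), 0, 8 * (q + α * γ), -(16 * (γ ^ 2 + 2 * r))⟩ : WeierstrassCurve ℤ_[2])).kodairaSymbolOfMinimal =
      .Istar 2 := by
  obtain ⟨ε, hε, hpε⟩ := Literature.NumberTheory.EllipticCurves.TwistGoodTwo.exists_isUnit_two_eq_uniformizer_mul_padicInt
  obtain ⟨κ, hκ⟩ := exists_eq_one_add_two_mul_of_isUnit_padicInt hα
  set ϖ : ℤ_[2] := uniformizer ℤ_[2] with hϖ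
  have hϖirr : Irreducible ϖ := irreducible_uniformizer
  have h2res : (2 : IsLocalRing.ResidueField ℤ_[2]) = 0 := residue_two_eq_zero hpε
  have h2m : (2 : ℤ_[2]) ∈ maximalIdeal ℤ_[2] := by
    rw [hpε]; exact Ideal.mul_mem_right _ _ (uniformizer_mem_maximalIdeal (R := ℤ_[2]))
  -- the model and its `y ↦ y + 4γ` translate, as literals
  set W₀ : WeierstrassCurve ℤ_[2] := ⟨2 * α, -(2 * (α ^ 2 + 2 * p)), 0, 8 * (q + α * γ), -(16 * (γ ^ 2 + 2 * r))⟩ with hW₀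
  set W₁ : WeierstrassCurve ℤ_[2] := ⟨2 * α, -(2 * (α ^ 2 + 2 * p)), 8 * γ, 8 * q, -(32 * (γ ^ 2 + r))⟩ with hW₁
  have hTW₀ : (⟨1, 0, α, 0⟩ : VariableChange ℤ_[2]) •
      (⟨0, -(α ^ 2 + 4 * p), 0, 8 * (q + α * γ), -(16 * (γ ^ 2 + 2 * r))⟩ : WeierstrassCurve ℤ_[2]) = W₀ := by
    rw [hW₀]
    ext <;> simp only [variableChange_a₁, variableChange_a₂, variableChange_a₃, variableChange_a₄, variableChange_a₆] <;>
      (simp; try ring)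
  have hW₁W₀ : W₁ = (⟨1, 0, 0, 4 * γ⟩ : VariableChange ℤ_[2]) • W₀ := by
    rw [hW₀, hW₁]
    ext <;> simp only [variableChange_a₁, variableChange_a₂, variableChange_a₃, variableChange_a₄, variableChange_a₆] <;>
      (simp; try ring)
  rw [hTW₀] at hΔ0 ⊢
  -- the unit `β = a₂/ϖ`
  set β : ℤ_[2] := -(ε * (1 + 2 * (2 * κ + 2 * κ ^ 2 + p))) with hβdef
  have hβ : IsUnit β := (hε.mul (isUnit_one_add_two_mul_padicInt _)).neg
  have ha₂ : -(2 * (α ^ 2 + 2 * p)) = ϖ * β := by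
    rw [hβdef, hκ]; linear_combination (-(1 + 2 * (2 * κ + 2 * κ ^ 2 + p))) * hpε
  have f8 : (8 : ℤ_[2]) = ϖ ^ 3 * ε ^ 3 := by rw [show (8 : ℤ_[2]) = 2 ^ 3 by norm_num, hpε]; ring
  have f16 : (16 : ℤ_[2]) = ϖ ^ 4 * ε ^ 4 := by rw [show (16 : ℤ_[2]) = 2 ^ 4 by norm_num, hpε]; ring
  have f32 : (32 : ℤ_[2]) = ϖ ^ 5 * ε ^ 5 := by rw [show (32 : ℤ_[2]) = 2 ^ 5 by norm_num, hpε]; ring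
  -- coefficients of `W₀`
  have c1 : W₀.a₁ = ϖ * (ε * α) := by simp only [hW₀]; linear_combination α * hpε
  have c2 : W₀.a₂ = ϖ * β := by simp only [hW₀]; exact ha₂
  have c3 : W₀.a₃ = 0 := by simp only [hW₀]
  have c4 : W₀.a₄ = ϖ ^ 3 * (ε ^ 3 * (q + α * γ)) := by simp only [hW₀]; rw [f8]; ring
  have c6 : W₀.a₆ = ϖ ^ 4 * (-(ε ^ 4 * (γ ^ 2 + 2 * r))) := by simp only [hW₀]; rw [f16]; ring
  -- coefficients of `W₁`
  have d1 : W₁.a₁ = ϖ * (ε * α) := by simp only [hW₁]; linear_combination α * hpε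
  have d2 : W₁.a₂ = ϖ * β := by simp only [hW₁]; exact ha₂
  have d3 : W₁.a₃ = ϖ ^ 3 * (ε ^ 3 * γ) := by simp only [hW₁]; rw [f8]; ring
  have d4 : W₁.a₄ = ϖ ^ 3 * (ε ^ 3 * q) := by simp only [hW₁]; rw [f8]; ring
  have d6 : W₁.a₆ = ϖ ^ 5 * (-(ε ^ 5 * (γ ^ 2 + r))) := by simp only [hW₁]; rw [f32]; ring
  -- `ord Δ ≥ 8`, fuel
  have hΔ8 : W₀.Δ ∈ maximalIdeal ℤ_[2] ^ (2 * 0 + 8) :=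
    Δ_mem_pow_of_istarRoundA_of_two_mem h2m W₀ 0
      (by rw [c1]; exact Ideal.mul_mem_right _ _ uniformizer_mem_maximalIdeal)
      (by rw [c2]; exact Ideal.mul_mem_right _ _ uniformizer_mem_maximalIdeal)
      (by rw [c3]; exact zero_mem _)
      (by rw [c4]; exact Ideal.mul_mem_right _ _ (Ideal.pow_mem_pow uniformizer_mem_maximalIdeal _))
      (by rw [c6]; exact Ideal.mul_mem_right _ _ (Ideal.pow_mem_pow uniformizer_mem_maximalIdeal _))
  have h8le : 8 ≤ (addVal ℤ_[2] W₀.Δ).toNat :=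
    le_addVal_toNat_of_pow_dvd hϖirr hΔ0 (mem_maximalIdeal_pow_iff_dvd.mp (by simpa using hΔ8))
  obtain ⟨f, hf⟩ : ∃ f, (addVal ℤ_[2] W₀.Δ).toNat = f + 1 := ⟨(addVal ℤ_[2] W₀.Δ).toNat - 1, by omega⟩
  have hΔdvd : ϖ ∣ W₀.Δ :=
    (dvd_pow_self ϖ (by norm_num : (8 : ℕ) ≠ 0)).trans (mem_maximalIdeal_pow_iff_dvd.mp (by simpa using hΔ8))
  -- route to the `Iₙ*` sub-procedure on `W₀` itself
  rw [kodairaSymbolOfMinimal_eq_Istar_istarIndexAux_self hpε (by rw [c1]; exact dvd_mul_right _ _) c2 hβ c3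
    (by rw [c4]; exact dvd_mul_right _ _) (by rw [c6]; exact dvd_mul_right _ _) hΔdvd, hf]
  congr 1
  -- round 0: test A fails, test B fires on `W₁`
  have hA : distinctRootCount
      (X ^ 2 + C (redCoeff W₀.a₃ (0 + 2)) * X - C (redCoeff W₀.a₆ (2 * 0 + 4))) ≠ 2 := by
    rw [redCoeff_eq_zero_of_dvd (by rw [c3]; exact dvd_zero _)]
    intro h
    exact ((testA_iff_of_two_eq_zero h2res _ _).mp h) rfl
  have hβres : IsLocalRing.residue ℤ_[2] β ≠ 0 := (isUnit_iff_residue_ne_zero β).mp hβ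
  have hqres : IsLocalRing.residue ℤ_[2] (ε ^ 3 * q) ≠ 0 := (isUnit_iff_residue_ne_zero _).mp ((hε.pow 3).mul hq)
  have hB : distinctRootCount (C (redCoeff W₁.a₂ 1) * X ^ 2 + C (redCoeff W₁.a₄ (0 + 3)) * X +
      C (redCoeff W₁.a₆ (2 * 0 + 5))) = 2 := by
    rw [d2, d4, d6, redCoeff_uniformizer_mul, show (0 + 3 : ℕ) = 3 from rfl, show (2 * 0 + 5 : ℕ) = 5 from rfl,
      redCoeff_uniformizer_pow_mul, redCoeff_uniformizer_pow_mul]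
    exact (testB_iff_of_two_eq_zero h2res hβres _ _).mpr hqres
  exact istarIndexAux_succ_of_testB (fuel := f) (m := 0) (by rw [c1]; exact dvd_mul_right _ _)
    (by rw [c2]; exact dvd_mul_right _ _) (by rw [c2]; exact not_sq_dvd_uniformizer_mul hβ)
    (by rw [c3]; exact dvd_zero _) (by rw [c4]; exact dvd_mul_right _ _) (by rw [c6]; exact dvd_mul_right _ _)
    hA hW₁W₀ (by rw [d1]; exact dvd_mul_right _ _) (by rw [d2]; exact dvd_mul_right _ _)
    (by rw [d2]; exact not_sq_dvd_uniformizer_mul hβ) (by rw [d3]; exact dvd_mul_right _ _)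
    (by rw [d4]; exact dvd_mul_right _ _) (by rw [d6]; exact dvd_mul_right _ _) hB

/-! ## §3 The exit at I₃* (the twist of the `II*`-form) -/

/-- **Exit at I₃*.**  For units `α, r` and any `p, γ, q ∈ ℤ₂`, Tate's algorithm returns `I₃*` on
`W₀ = (1,0,α,0) • [0, −(α² + 4p), 0, 8(αγ + 2q), −16(γ² + 2r)] = [2α, −2(α² + 2p), 0, 8(αγ + 2q), −16(γ² + 2r)]` (granted `Δ ≠ 0`):
round `0` of the `Iₙ*` sub-procedure fails test A (`a₃ = 0`) and, on `W₁ = [2α, −2(α² + 2p), 8γ, 16q, −32(γ² + r)]` (`y ↦ y + 4γ`), test B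
(`a₄/8 = 2q ≡ 0`); with `ρ` such that `2 ∣ γ² + r + α²ρ²` (perfect residue field) the translate `x ↦ x + 4ρ` is normalised for round `1`,
whose test A fires because `a₃/8 = γ + αρ` has square `≡ −r`, a unit: `n = 3`. [cite: SilvermanATAEC1994, IV.9.4 Steps 1–7] -/
theorem kodairaSymbolOfMinimal_negTwist_toIstarThree (α p γ q r : ℤ_[2]) (hα : IsUnit α) (hr : IsUnit r)
    (hΔ0 : ((⟨1, 0, α, 0⟩ : VariableChange ℤ_[2]) •
        (⟨0, -(α ^ 2 + 4 * p), 0, 8 * (α * γ + 2 * q), -(16 * (γ ^ 2 + 2 * r))⟩ : WeierstrassCurve ℤ_[2])).Δ ≠ 0) :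
    ((⟨1, 0, α, 0⟩ : VariableChange ℤ_[2]) •
        (⟨0, -(α ^ 2 + 4 * p), 0, 8 * (α * γ + 2 * q), -(16 * (γ ^ 2 + 2 * r))⟩ : WeierstrassCurve ℤ_[2])).kodairaSymbolOfMinimal =
      .Istar 3 := by
  obtain ⟨ε, hε, hpε⟩ := Literature.NumberTheory.EllipticCurves.TwistGoodTwo.exists_isUnit_two_eq_uniformizer_mul_padicInt
  obtain ⟨κ, hκ⟩ := exists_eq_one_add_two_mul_of_isUnit_padicInt hα
  obtain ⟨κr, hκr⟩ := exists_eq_one_add_two_mul_of_isUnit_padicInt hr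
  set ϖ : ℤ_[2] := uniformizer ℤ_[2] with hϖ
  have hϖirr : Irreducible ϖ := irreducible_uniformizer
  have h2res : (2 : IsLocalRing.ResidueField ℤ_[2]) = 0 := residue_two_eq_zero hpε
  have h2m : (2 : ℤ_[2]) ∈ maximalIdeal ℤ_[2] := by
    rw [hpε]; exact Ideal.mul_mem_right _ _ (uniformizer_mem_maximalIdeal (R := ℤ_[2]))
  -- the square root `ρ` of `−(γ² + r)/α²` modulo `ϖ`
  obtain ⟨ρ, hρ⟩ := exists_dvd_add_mul_sq h2res (hα.pow 2) (γ ^ 2 + r)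
  obtain ⟨σ, hσ⟩ := hρ
  -- the models, as literals
  set W₀ : WeierstrassCurve ℤ_[2] := ⟨2 * α, -(2 * (α ^ 2 + 2 * p)), 0, 8 * (α * γ + 2 * q), -(16 * (γ ^ 2 + 2 * r))⟩ with hW₀
  set W₁ : WeierstrassCurve ℤ_[2] := ⟨2 * α, -(2 * (α ^ 2 + 2 * p)), 8 * γ, 16 * q, -(32 * (γ ^ 2 + r))⟩ with hW₁
  set W₂ : WeierstrassCurve ℤ_[2] := ⟨2 * α, -(2 * (α ^ 2 + 2 * p)) + 12 * ρ, 8 * (γ + α * ρ),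
    16 * (q - ρ * (α ^ 2 + 2 * p) + 3 * ρ ^ 2),
    -(32 * (γ ^ 2 + r)) + 64 * ρ * q - 32 * ρ ^ 2 * (α ^ 2 + 2 * p) + 64 * ρ ^ 3⟩ with hW₂
  have hTW₀ : (⟨1, 0, α, 0⟩ : VariableChange ℤ_[2]) •
      (⟨0, -(α ^ 2 + 4 * p), 0, 8 * (α * γ + 2 * q), -(16 * (γ ^ 2 + 2 * r))⟩ : WeierstrassCurve ℤ_[2]) = W₀ := by
    rw [hW₀]
    ext <;> simp only [variableChange_a₁, variableChange_a₂, variableChange_a₃, variableChange_a₄, variableChange_a₆] <;>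
      (simp; try ring)
  have hW₁W₀ : W₁ = (⟨1, 0, 0, 4 * γ⟩ : VariableChange ℤ_[2]) • W₀ := by
    rw [hW₀, hW₁]
    ext <;> simp only [variableChange_a₁, variableChange_a₂, variableChange_a₃, variableChange_a₄, variableChange_a₆] <;>
      (simp; try ring)
  have hW₂W₁ : W₂ = (⟨1, 4 * ρ, 0, 0⟩ : VariableChange ℤ_[2]) • W₁ := by
    rw [hW₁, hW₂]
    ext <;> simp only [variableChange_a₁, variableChange_a₂, variableChange_a₃, variableChange_a₄, variableChange_a₆] <;>
      (simp; try ring)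
  rw [hTW₀] at hΔ0 ⊢
  -- the units `a₂/ϖ`
  set β : ℤ_[2] := -(ε * (1 + 2 * (2 * κ + 2 * κ ^ 2 + p))) with hβdef
  have hβ : IsUnit β := (hε.mul (isUnit_one_add_two_mul_padicInt _)).neg
  have ha₂ : -(2 * (α ^ 2 + 2 * p)) = ϖ * β := by
    rw [hβdef, hκ]; linear_combination (-(1 + 2 * (2 * κ + 2 * κ ^ 2 + p))) * hpε
  set β₂ : ℤ_[2] := -(ε * (1 + 2 * (2 * κ + 2 * κ ^ 2 + p - 3 * ρ))) with hβ₂def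
  have hβ₂ : IsUnit β₂ := (hε.mul (isUnit_one_add_two_mul_padicInt _)).neg
  have ha₂' : -(2 * (α ^ 2 + 2 * p)) + 12 * ρ = ϖ * β₂ := by
    rw [hβ₂def, hκ]; linear_combination (-(1 + 2 * (2 * κ + 2 * κ ^ 2 + p - 3 * ρ))) * hpε
  have f8 : (8 : ℤ_[2]) = ϖ ^ 3 * ε ^ 3 := by rw [show (8 : ℤ_[2]) = 2 ^ 3 by norm_num, hpε]; ring
  have f16 : (16 : ℤ_[2]) = ϖ ^ 4 * ε ^ 4 := by rw [show (16 : ℤ_[2]) = 2 ^ 4 by norm_num, hpε]; ring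
  have f32 : (32 : ℤ_[2]) = ϖ ^ 5 * ε ^ 5 := by rw [show (32 : ℤ_[2]) = 2 ^ 5 by norm_num, hpε]; ring
  have f64 : (64 : ℤ_[2]) = ϖ ^ 6 * ε ^ 6 := by rw [show (64 : ℤ_[2]) = 2 ^ 6 by norm_num, hpε]; ring
  have f12 : (12 : ℤ_[2]) = ϖ * (6 * ε) := by linear_combination 6 * hpε
  -- coefficients of `W₀`
  have c1 : W₀.a₁ = ϖ * (ε * α) := by simp only [hW₀]; linear_combination α * hpε
  have c2 : W₀.a₂ = ϖ * β := by simp only [hW₀]; exact ha₂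
  have c3 : W₀.a₃ = 0 := by simp only [hW₀]
  have c4 : W₀.a₄ = ϖ ^ 3 * (ε ^ 3 * (α * γ + 2 * q)) := by simp only [hW₀]; rw [f8]; ring
  have c6 : W₀.a₆ = ϖ ^ 4 * (-(ε ^ 4 * (γ ^ 2 + 2 * r))) := by simp only [hW₀]; rw [f16]; ring
  -- coefficients of `W₁`
  have d1 : W₁.a₁ = ϖ * (ε * α) := by simp only [hW₁]; linear_combination α * hpε
  have d2 : W₁.a₂ = ϖ * β := by simp only [hW₁]; exact ha₂
  have d3 : W₁.a₃ = ϖ ^ 3 * (ε ^ 3 * γ) := by simp only [hW₁]; rw [f8]; ring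
  have d4 : W₁.a₄ = ϖ ^ 3 * (ϖ * (ε ^ 4 * q)) := by simp only [hW₁]; rw [f16]; ring
  have d6 : W₁.a₆ = ϖ ^ 5 * (-(ε ^ 5 * (γ ^ 2 + r))) := by simp only [hW₁]; rw [f32]; ring
  -- coefficients of `W₂`
  have g1 : W₂.a₁ = ϖ * (ε * α) := by simp only [hW₂]; linear_combination α * hpε
  have g2 : W₂.a₂ = ϖ * β₂ := by simp only [hW₂]; exact ha₂'
  have g3 : W₂.a₃ = ϖ ^ 3 * (ε ^ 3 * (γ + α * ρ)) := by simp only [hW₂]; rw [f8]; ring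
  have g4 : W₂.a₄ = ϖ ^ 4 * (ε ^ 4 * (q - ρ * (α ^ 2 + 2 * p) + 3 * ρ ^ 2)) := by simp only [hW₂]; rw [f16]; ring
  have g6 : W₂.a₆ = ϖ ^ 6 * (-(ε ^ 5 * σ) + ε ^ 6 * (ρ * q + ρ ^ 3 - p * ρ ^ 2)) := by
    simp only [hW₂]; rw [f32, f64]
    linear_combination (-(ϖ ^ 5 * ε ^ 5)) * hσ + (-(ϖ ^ 5 * ε ^ 5 * p * ρ ^ 2)) * hpε
  -- `ord Δ ≥ 8`, fuel
  have hΔ8 : W₀.Δ ∈ maximalIdeal ℤ_[2] ^ (2 * 0 + 8) :=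
    Δ_mem_pow_of_istarRoundA_of_two_mem h2m W₀ 0
      (by rw [c1]; exact Ideal.mul_mem_right _ _ uniformizer_mem_maximalIdeal)
      (by rw [c2]; exact Ideal.mul_mem_right _ _ uniformizer_mem_maximalIdeal)
      (by rw [c3]; exact zero_mem _)
      (by rw [c4]; exact Ideal.mul_mem_right _ _ (Ideal.pow_mem_pow uniformizer_mem_maximalIdeal _))
      (by rw [c6]; exact Ideal.mul_mem_right _ _ (Ideal.pow_mem_pow uniformizer_mem_maximalIdeal _))
  have h8le : 8 ≤ (addVal ℤ_[2] W₀.Δ).toNat :=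
    le_addVal_toNat_of_pow_dvd hϖirr hΔ0 (mem_maximalIdeal_pow_iff_dvd.mp (by simpa using hΔ8))
  obtain ⟨f, hf⟩ : ∃ f, (addVal ℤ_[2] W₀.Δ).toNat = f + 1 + 1 := ⟨(addVal ℤ_[2] W₀.Δ).toNat - 2, by omega⟩
  have hΔdvd : ϖ ∣ W₀.Δ :=
    (dvd_pow_self ϖ (by norm_num : (8 : ℕ) ≠ 0)).trans (mem_maximalIdeal_pow_iff_dvd.mp (by simpa using hΔ8))
  -- route to the `Iₙ*` sub-procedure on `W₀` itself
  rw [kodairaSymbolOfMinimal_eq_Istar_istarIndexAux_self hpε (by rw [c1]; exact dvd_mul_right _ _) c2 hβ c3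
    (by rw [c4]; exact dvd_mul_right _ _) (by rw [c6]; exact dvd_mul_right _ _) hΔdvd, hf]
  congr 1
  -- round 0: both tests fail
  have hA0 : distinctRootCount
      (X ^ 2 + C (redCoeff W₀.a₃ (0 + 2)) * X - C (redCoeff W₀.a₆ (2 * 0 + 4))) ≠ 2 := by
    rw [redCoeff_eq_zero_of_dvd (by rw [c3]; exact dvd_zero _)]
    intro h
    exact ((testA_iff_of_two_eq_zero h2res _ _).mp h) rfl
  have hβres : IsLocalRing.residue ℤ_[2] β ≠ 0 := (isUnit_iff_residue_ne_zero β).mp hβ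
  have hB0 : distinctRootCount (C (redCoeff W₁.a₂ 1) * X ^ 2 + C (redCoeff W₁.a₄ (0 + 3)) * X +
      C (redCoeff W₁.a₆ (2 * 0 + 5))) ≠ 2 := by
    rw [d2, d4, redCoeff_uniformizer_mul, show (0 + 3 : ℕ) = 3 from rfl, redCoeff_uniformizer_pow_mul]
    intro h
    refine ((testB_iff_of_two_eq_zero h2res hβres _ _).mp h) ?_
    exact (IsLocalRing.residue_eq_zero_iff _).mpr (Ideal.mul_mem_right _ _ uniformizer_mem_maximalIdeal)
  have hstep := istarIndexAux_succ_of_not_testB (fuel := f + 1) (m := 0) (by rw [c1]; exact dvd_mul_right _ _)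
    (by rw [c2]; exact dvd_mul_right _ _) (by rw [c2]; exact not_sq_dvd_uniformizer_mul hβ)
    (by rw [c3]; exact dvd_zero _) (by rw [c4]; exact dvd_mul_right _ _) (by rw [c6]; exact dvd_mul_right _ _)
    hA0 hW₁W₀ (by rw [d1]; exact dvd_mul_right _ _) (by rw [d2]; exact dvd_mul_right _ _)
    (by rw [d2]; exact not_sq_dvd_uniformizer_mul hβ) (by rw [d3]; exact dvd_mul_right _ _)
    (by rw [d4]; exact dvd_mul_right _ _) (by rw [d6]; exact dvd_mul_right _ _) hB0 hW₂W₁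
    (by rw [g1]; exact dvd_mul_right _ _) (by rw [g2]; exact dvd_mul_right _ _)
    (by rw [g2]; exact not_sq_dvd_uniformizer_mul hβ₂) (by rw [g3]; exact dvd_mul_right _ _)
    (by rw [g4]; exact dvd_mul_right _ _) (by rw [g6]; exact dvd_mul_right _ _)
  rw [hstep]
  -- round 1: test A fires since `γ + αρ` is a unit
  have hc : IsUnit (2 * α * γ * ρ - r) := by
    rw [show 2 * α * γ * ρ - r = -(1 + 2 * (κr - α * γ * ρ)) by rw [hκr]; ring]
    exact (isUnit_one_add_two_mul_padicInt _).neg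
  have hτ : IsUnit (γ + α * ρ) :=
    isUnit_of_dvd_sub_sq hc ⟨-σ, by linear_combination (-1 : ℤ_[2]) * hσ⟩
  have hτres : IsLocalRing.residue ℤ_[2] (ε ^ 3 * (γ + α * ρ)) ≠ 0 :=
    (isUnit_iff_residue_ne_zero _).mp ((hε.pow 3).mul hτ)
  have hA1 : distinctRootCount
      (X ^ 2 + C (redCoeff W₂.a₃ (1 + 2)) * X - C (redCoeff W₂.a₆ (2 * 1 + 4))) = 2 := by
    rw [g3, show (1 + 2 : ℕ) = 3 from rfl, redCoeff_uniformizer_pow_mul]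
    exact (testA_iff_of_two_eq_zero h2res _ _).mpr hτres
  exact istarIndexAux_succ_of_testA f 1 W₂ hA1

end Summit.BirchSwinnertonDyer.BirchSwinnertonDyer.Theorems.ManinLocalTwoThree

end
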